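import Summits.Schanuel.Schanuel.Theorems.RootDecomp1EWallDichotomy02
import Summits.Schanuel.Schanuel.Theorems.RootDecomp1KHyper25

/-!
# RootDecomp1EWallDichotomy — lens 2, generation 40 «(c⁗) WALL DICHOTOMY: TWISTED vs UNTWISTED 1-fold SCALES» (BOOKKEEPING node per RULING L1949: wall-text correction + cross-route instance; the twisted side = tree-corollary of lens 4's frame engine, VARIANT-REACH, no cell credit; member z⋄ = zTwin 2 i (√2·λ_H) with a FINITE-irrationality-exponent certificate) — continuation (RootDecomp1EWallDichotomy03): §4 POSITION CERTIFICATE: `Tdia = √2·λ_H` has irrationality exponent ≤ 10 (`irrationality_measure_Tdia`, `not_liouville_Tdia`)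

(lens-2 g40 `WallDichotomy.lean` [HOME/decomp-schanuel-lens-2/g40/ sha256 beadd3d7…, 1177 l; NODE L1955 / REQUEST L1956; critic VERDICT L1964 (bookkeeping, no credit, port GO low)]; port by census-1 gen 17 as
`RootDecomp1EWallDichotomy01`–`04` — see the PORT NOTE of part 01; `--supports stmt-Schanuel-31409`; bookkeeping node, no credit; rung 0.)
-/

noncomputable section

open Complex IntermediateField

open Summit.Schanuel.Schanuel.Theorems.RootDecomp1KHyper.HyperCell (HyperLiouville hexp hexp_succ hexp_lt_succ
  one_le_hexp succ_le_hexp lambdaH summable_lambdaH hyperLiouville_lambdaH)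
open Summit.Schanuel.Schanuel.Theorems.RootDecomp1BHyperFrame (FrameMeasure frameMeasure_of_roy
  algebraicIndependent_cons_of_frameMeasure trdeg_adjoin_le_of_isAlgebraic' hyperFrame polarVec polarExpo
  polarDeg_hyperFrame_ge)
open Summit.Schanuel.Schanuel.Theorems.RootDecomp1BFedFlagCore (polarDeg)
open Summit.Schanuel.Schanuel.Theorems.RootDecomp1EPointTransfer (Roy2014_thm_1_1 InPointClass lambdaH_convergent)
open Summit.Schanuel.Schanuel.Theorems.RootDecomp1ELWTransport (zTwin zTwin_left zTwin_right linearIndependent_zTwin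
  dblMoments InLWClass DyadicHyper₂)
open Summit.Schanuel.Schanuel.Theorems.RootDecomp1ETwoScale (CoveredTower InTwoScaleClass)
open Summit.Schanuel.Schanuel.Theorems.RootDecomp1EScaleTransfer (InScaleClass HyperScaleApprox)

open Summit.Schanuel.Schanuel.Theorems.RootDecomp1KHyper.HyperCell (lambdaH_le_one)

namespace Summit.Schanuel.Schanuel.Theorems.RootDecomp1EWallDichotomy

/-! ## §4  POSITION CERTIFICATE (hypothesis-free): `T⋄ = √2·λ_H` has FINITE irrationality exponent -/

/-- **Liouville's inequality for `√2`, integer form:** `|√2·X − Y| ≥ 1/(4X)` for naturals `X ≥ 1`, integers `Y`. -/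
theorem sqrt_two_int_lower {X : ℕ} (hX : 1 ≤ X) (Y : ℤ) :
    1 / (4 * (X : ℝ)) ≤ |Real.sqrt 2 * X - Y| := by
  have hXpos : (0 : ℝ) < X := by exact_mod_cast hX
  have hX1 : (1 : ℝ) ≤ X := by exact_mod_cast hX
  have hs0 : 0 < Real.sqrt 2 := Real.sqrt_pos.mpr two_pos
  have hs2 : Real.sqrt 2 ^ 2 = 2 := Real.sq_sqrt (by norm_num)
  have hs3 : Real.sqrt 2 < 3 / 2 := by nlinarith [hs2, hs0]
  by_cases h1 : 1 ≤ |Real.sqrt 2 * X - Y|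
  · refine le_trans ?_ h1
    rw [div_le_one (by positivity)]; linarith
  · rw [not_le] at h1
    -- the integer `2X² − Y²` is non-zero (`√2 ∉ ℚ`)
    have hint : (2 * (X : ℤ) ^ 2 - Y ^ 2 : ℤ) ≠ 0 := by
      intro h0
      have hYX : ((Y : ℝ) / X) ^ 2 = 2 := by
        have h0' : ((Y : ℤ) ^ 2 : ℤ) = 2 * X ^ 2 := by linarith
        have : (Y : ℝ) ^ 2 = 2 * (X : ℝ) ^ 2 := by exact_mod_cast h0'
        rw [div_pow, this]; field_simp
      have habs : |(Y : ℝ) / X| = Real.sqrt 2 := by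
        rw [← Real.sqrt_sq_eq_abs, hYX]
      exact irrational_sqrt_two ⟨|(Y : ℚ) / X|, by push_cast; exact habs⟩
    have h1le : (1 : ℝ) ≤ |2 * (X : ℝ) ^ 2 - (Y : ℝ) ^ 2| := by
      have : (1 : ℤ) ≤ |2 * (X : ℤ) ^ 2 - Y ^ 2| := Int.one_le_abs hint
      exact_mod_cast this
    have hfac : 2 * (X : ℝ) ^ 2 - (Y : ℝ) ^ 2 = (Real.sqrt 2 * X - Y) * (Real.sqrt 2 * X + Y) := by
      have : (Real.sqrt 2 * X - Y) * (Real.sqrt 2 * X + Y) = Real.sqrt 2 ^ 2 * X ^ 2 - Y ^ 2 := by ring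
      rw [this, hs2]
    have hplus : |Real.sqrt 2 * X + Y| ≤ 4 * X := by
      have e : Real.sqrt 2 * X + Y = 2 * (Real.sqrt 2 * X) - (Real.sqrt 2 * X - Y) := by ring
      rw [e]
      refine (abs_sub _ _).trans ?_
      rw [abs_of_pos (by positivity)]
      have : 2 * (Real.sqrt 2 * X) ≤ 3 * X := by nlinarith
      linarith [h1.le]
    have hprod : 1 ≤ |Real.sqrt 2 * X - Y| * (4 * X) :=
      calc (1 : ℝ) ≤ |2 * (X : ℝ) ^ 2 - (Y : ℝ) ^ 2| := h1le
        _ = |Real.sqrt 2 * X - Y| * |Real.sqrt 2 * X + Y| := by rw [hfac, abs_mul]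
        _ ≤ |Real.sqrt 2 * X - Y| * (4 * X) := mul_le_mul_of_nonneg_left hplus (abs_nonneg _)
    rw [div_le_iff₀ (by positivity)]
    linarith

/-- **The convergent bound.**  With `S_L = Σ_{k≤L} 2^{−a_k} = M/2^{a_L}` (`M` odd, `M ≤ 2^{a_L}`):
`|√2·S_L − p/q| ≥ 1/(4 · 4^{a_L} · q²)` for every integer `p` and natural `q ≥ 1`. -/
theorem sqrt_two_convergent_lower (L : ℕ) (p : ℤ) {q : ℕ} (hq : 1 ≤ q) :
    1 / (4 * ((2 : ℝ) ^ hexp L) ^ 2 * (q : ℝ) ^ 2) ≤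
      |Real.sqrt 2 * (∑ k ∈ Finset.range (L + 1), 1 / (2 : ℝ) ^ hexp k) - (p : ℝ) / q| := by
  obtain ⟨M, hModd, hsum, hlo, -, -⟩ := lambdaH_convergent L
  set A : ℝ := (2 : ℝ) ^ hexp L with hA
  have hA0 : 0 < A := by positivity
  have hq0 : (0 : ℝ) < q := by exact_mod_cast hq
  have hM1 : 1 ≤ M := by obtain ⟨t, rfl⟩ := hModd; omega
  -- `M ≤ A` because `S_L ≤ λ_H ≤ 1`
  have hMA : (M : ℝ) ≤ A := by
    have hS : (M : ℝ) / A ≤ 1 := by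
      rw [← hsum]
      have : (0 : ℝ) < 1 / (2 : ℝ) ^ hexp (L + 1) := by positivity
      linarith [lambdaH_le_one]
    rwa [div_le_one hA0] at hS
  rw [hsum]
  have hAq : 0 < A * q := mul_pos hA0 hq0
  have hAne : A ≠ 0 := hA0.ne'
  have hqne : (q : ℝ) ≠ 0 := hq0.ne'
  -- `√2·M/A − p/q = (√2·(Mq) − pA)/(Aq)`
  have e : Real.sqrt 2 * ((M : ℝ) / A) - (p : ℝ) / q =
      (Real.sqrt 2 * ((M * q : ℕ) : ℝ) - ((p * (2 ^ hexp L : ℕ) : ℤ) : ℝ)) / (A * q) := by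
    have hc : ((p * (2 ^ hexp L : ℕ) : ℤ) : ℝ) = (p : ℝ) * A := by push_cast; rw [hA]
    rw [hc, Nat.cast_mul]
    field_simp
  rw [e, abs_div, abs_of_pos hAq, le_div_iff₀ hAq]
  have hX : 1 ≤ M * q := Nat.one_le_iff_ne_zero.mpr (Nat.mul_ne_zero (by omega) (by omega))
  have hL := sqrt_two_int_lower hX (p * (2 ^ hexp L : ℕ))
  have hMq : (0 : ℝ) < ((M * q : ℕ) : ℝ) := by exact_mod_cast hX
  calc 1 / (4 * A ^ 2 * (q : ℝ) ^ 2) * (A * q) = 1 / (4 * (A * q)) := by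
        field_simp
    _ ≤ 1 / (4 * (((M * q : ℕ)) : ℝ)) := by
        apply one_div_le_one_div_of_le (by positivity)
        push_cast; nlinarith
    _ ≤ _ := hL

/-- `10a + 20 ≤ 2^{3a}` for `a ≥ 3`. -/
private theorem ten_mul_add_le_pow {a : ℕ} (ha : 3 ≤ a) : 10 * a + 20 ≤ 2 ^ (3 * a) := by
  induction a, ha using Nat.le_induction with
  | base => norm_num
  | succ n hn ih =>
      have h8 : 2 ^ (3 * (n + 1)) = 2 ^ (3 * n) * 8 := by
        rw [show 3 * (n + 1) = 3 * n + 3 by ring, pow_add]; norm_num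
      have h512 : 512 ≤ 2 ^ (3 * n) :=
        calc 512 = 2 ^ (3 * 3) := by norm_num
          _ ≤ 2 ^ (3 * n) := Nat.pow_le_pow_right two_pos (by omega)
      omega

/-- `a_2 = 16`. -/
theorem hexp_two : hexp 2 = 16 := by
  rw [hexp_succ, hexp_succ, Summit.Schanuel.Schanuel.Theorems.RootDecomp1KHyper.HyperCell.hexp_zero]; norm_num

/-- The tower gap used in window (ii): `2^{a_{L+2}} ≥ 2^20 · (2^{a_{L+1}})^{10}` for `L ≥ 1`. -/
theorem tower_gap {L : ℕ} (hL : 1 ≤ L) :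
    (2 : ℝ) ^ 20 * ((2 : ℝ) ^ hexp (L + 1)) ^ 10 ≤ (2 : ℝ) ^ hexp (L + 2) := by
  have ha3 : 3 ≤ hexp (L + 1) := by
    have := (Summit.Schanuel.Schanuel.Theorems.RootDecomp1KHyper.HyperCell.hexp_strictMono).monotone
      (show 2 ≤ L + 1 by omega)
    rw [hexp_two] at this
    omega
  have hexp2 : 20 + hexp (L + 1) * 10 ≤ hexp (L + 2) := by
    rw [show L + 2 = (L + 1) + 1 by ring, hexp_succ]
    calc 20 + hexp (L + 1) * 10 ≤ 2 ^ (3 * hexp (L + 1)) := by have := ten_mul_add_le_pow ha3; omega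
      _ ≤ 2 ^ ((L + 1 + 1) * hexp (L + 1)) :=
          Nat.pow_le_pow_right two_pos (Nat.mul_le_mul_right _ (by omega))
  calc (2 : ℝ) ^ 20 * ((2 : ℝ) ^ hexp (L + 1)) ^ 10 = (2 : ℝ) ^ (20 + hexp (L + 1) * 10) := by
        rw [pow_add, pow_mul]
    _ ≤ (2 : ℝ) ^ hexp (L + 2) := pow_le_pow_right₀ one_le_two hexp2

/-- **IRRATIONALITY MEASURE OF `T⋄ = √2·λ_H` (hypothesis-free): `|T⋄ − p/q| ≥ 1/(2^20 · q^10)` for every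
integer `p` and every natural `q > 4`.**  Proof: let `L ≥ 1` be the level with `2^{a_L} < q ≤ 2^{a_{L+1}} =: B`.
Window (i) `2^8 q^4 ≤ B`: the convergent `S_L` gives `1/(4q⁴) − 3/B ≥ 1/(8q⁴)`.  Window (ii) `B < 2^8 q^4`: the
convergent `S_{L+1}` gives `1/(2^18 q^10) − 3/2^{a_{L+2}} ≥ 1/(2^20 q^10)` by the tower gap. -/
theorem irrationality_measure_Tdia (p : ℤ) {q : ℕ} (hq : 4 < q) :
    1 / ((2 : ℝ) ^ 20 * (q : ℝ) ^ 10) ≤ |Tdia - (p : ℝ) / q| := by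
  have hq1 : 1 ≤ q := by omega
  have hqR : (4 : ℝ) < q := by exact_mod_cast hq
  have hq1R : (1 : ℝ) ≤ q := by exact_mod_cast hq1
  have hs0 : 0 < Real.sqrt 2 := Real.sqrt_pos.mpr two_pos
  have hs2 : Real.sqrt 2 ^ 2 = 2 := Real.sq_sqrt (by norm_num)
  have hs3 : Real.sqrt 2 < 3 / 2 := by nlinarith [hs2, hs0]
  -- the level `L`: least with `q ≤ 2^{a_{L+1}}`
  have hex : ∃ L : ℕ, q ≤ 2 ^ hexp (L + 1) :=
    ⟨q, (Nat.lt_two_pow_self).le.trans (Nat.pow_le_pow_right two_pos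
      (by have := succ_le_hexp (q + 1); omega))⟩
  classical
  let L := Nat.find hex
  have hLB : q ≤ 2 ^ hexp (L + 1) := Nat.find_spec hex
  have hL1 : 1 ≤ L := by
    by_contra h0
    have hL0 : L = 0 := by omega
    have : q ≤ 2 ^ hexp 1 := by simpa [hL0] using hLB
    rw [hexp_succ] at this; simp at this; omega
  have hLA : 2 ^ hexp L < q := by
    have := Nat.find_min hex (show L - 1 < L by omega)
    rw [show L - 1 + 1 = L by omega] at this
    omega
  -- real names
  set A : ℝ := (2 : ℝ) ^ hexp L with hA
  set B : ℝ := (2 : ℝ) ^ hexp (L + 1) with hB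
  set C : ℝ := (2 : ℝ) ^ hexp (L + 2) with hC
  have hA0 : 0 < A := by positivity
  have hB0 : 0 < B := by positivity
  have hC0 : 0 < C := by positivity
  have hAq : A < q := by rw [hA]; exact_mod_cast hLA
  have hqB : (q : ℝ) ≤ B := by rw [hB]; exact_mod_cast hLB
  -- partial sums and tails
  set SL : ℝ := ∑ k ∈ Finset.range (L + 1), 1 / (2 : ℝ) ^ hexp k with hSL
  set SL1 : ℝ := ∑ k ∈ Finset.range (L + 1 + 1), 1 / (2 : ℝ) ^ hexp k with hSL1
  obtain ⟨-, -, -, hloL, hhiL, -⟩ := lambdaH_convergent L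
  obtain ⟨-, -, -, hloL1, hhiL1, -⟩ := lambdaH_convergent (L + 1)
  have htailL : lambdaH - SL ≤ 2 / B := by
    have e : (2 : ℝ) / B = 2 * (1 / B) := by ring
    rw [e, hB]; exact hhiL
  have htailL1 : lambdaH - SL1 ≤ 2 / C := by
    have e : (2 : ℝ) / C = 2 * (1 / C) := by ring
    rw [e, hC]; exact hhiL1
  have hposL : 0 ≤ lambdaH - SL :=
    le_trans (by positivity : (0 : ℝ) ≤ 1 / (2 : ℝ) ^ hexp (L + 1)) hloL
  have hposL1 : 0 ≤ lambdaH - SL1 :=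
    le_trans (by positivity : (0 : ℝ) ≤ 1 / (2 : ℝ) ^ hexp (L + 1 + 1)) hloL1
  -- the two convergent bounds
  have hconvL := sqrt_two_convergent_lower L p hq1
  have hconvL1 := sqrt_two_convergent_lower (L + 1) p hq1
  rw [← hSL] at hconvL; rw [← hSL1] at hconvL1
  -- triangle inequality: `|T⋄ − p/q| ≥ |√2 S − p/q| − √2 (λ − S)`
  have htri : ∀ S : ℝ, 0 ≤ lambdaH - S →
      |Real.sqrt 2 * S - (p : ℝ) / q| - Real.sqrt 2 * (lambdaH - S) ≤ |Tdia - (p : ℝ) / q| := by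
    intro S hS
    have e : Real.sqrt 2 * S - (p : ℝ) / q = (Tdia - (p : ℝ) / q) - Real.sqrt 2 * (lambdaH - S) := by
      unfold Tdia; ring
    rw [e]
    have := abs_sub (Tdia - (p : ℝ) / q) (Real.sqrt 2 * (lambdaH - S))
    rw [abs_of_nonneg (by positivity : 0 ≤ Real.sqrt 2 * (lambdaH - S))] at this
    linarith
  by_cases hwin : (2 : ℝ) ^ 8 * (q : ℝ) ^ 4 ≤ B
  · -- window (i): convergent `S_L`
    refine le_trans ?_ (htri SL hposL)
    have h1 : 1 / (4 * (q : ℝ) ^ 4) ≤ |Real.sqrt 2 * SL - (p : ℝ) / q| := by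
      refine le_trans ?_ hconvL
      rw [← hA]
      apply one_div_le_one_div_of_le (by positivity)
      have : A ^ 2 ≤ (q : ℝ) ^ 2 := by nlinarith
      nlinarith
    have h2 : Real.sqrt 2 * (lambdaH - SL) ≤ 3 / ((2 : ℝ) ^ 8 * (q : ℝ) ^ 4) := by
      calc Real.sqrt 2 * (lambdaH - SL) ≤ (3 / 2) * (lambdaH - SL) :=
            mul_le_mul_of_nonneg_right hs3.le hposL
        _ ≤ (3 / 2) * (2 / B) := mul_le_mul_of_nonneg_left htailL (by norm_num)
        _ = 3 / B := by ring
        _ ≤ 3 / ((2 : ℝ) ^ 8 * (q : ℝ) ^ 4) := div_le_div_of_nonneg_left (by norm_num) (by positivity) hwin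
    have hq4 : (0 : ℝ) < (q : ℝ) ^ 4 := by positivity
    have hq10 : (q : ℝ) ^ 4 ≤ (q : ℝ) ^ 10 := pow_le_pow_right₀ hq1R (by norm_num)
    have : 1 / ((2 : ℝ) ^ 20 * (q : ℝ) ^ 10) ≤ 1 / (4 * (q : ℝ) ^ 4) - 3 / ((2 : ℝ) ^ 8 * (q : ℝ) ^ 4) := by
      rw [div_sub_div _ _ (by positivity) (by positivity), div_le_div_iff₀ (by positivity) (by positivity)]
      nlinarith
    linarith
  · -- window (ii): convergent `S_{L+1}`
    rw [not_le] at hwin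
    refine le_trans ?_ (htri SL1 hposL1)
    have h1 : 1 / ((2 : ℝ) ^ 18 * (q : ℝ) ^ 10) ≤ |Real.sqrt 2 * SL1 - (p : ℝ) / q| := by
      refine le_trans ?_ hconvL1
      rw [← hB]
      apply one_div_le_one_div_of_le (by positivity)
      have : B ^ 2 ≤ ((2 : ℝ) ^ 8 * (q : ℝ) ^ 4) ^ 2 := by nlinarith
      nlinarith
    have hCq : (2 : ℝ) ^ 20 * (q : ℝ) ^ 10 ≤ C := by
      calc (2 : ℝ) ^ 20 * (q : ℝ) ^ 10 ≤ (2 : ℝ) ^ 20 * B ^ 10 :=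
            mul_le_mul_of_nonneg_left (pow_le_pow_left₀ (by positivity) hqB 10) (by positivity)
        _ ≤ C := by rw [hB, hC]; exact tower_gap hL1
    have h2 : Real.sqrt 2 * (lambdaH - SL1) ≤ 3 / ((2 : ℝ) ^ 20 * (q : ℝ) ^ 10) := by
      calc Real.sqrt 2 * (lambdaH - SL1) ≤ (3 / 2) * (lambdaH - SL1) :=
            mul_le_mul_of_nonneg_right hs3.le hposL1
        _ ≤ (3 / 2) * (2 / C) := mul_le_mul_of_nonneg_left htailL1 (by norm_num)
        _ = 3 / C := by ring
        _ ≤ 3 / ((2 : ℝ) ^ 20 * (q : ℝ) ^ 10) := div_le_div_of_nonneg_left (by norm_num) (by positivity) hCq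
    have : 1 / ((2 : ℝ) ^ 20 * (q : ℝ) ^ 10) =
        1 / ((2 : ℝ) ^ 18 * (q : ℝ) ^ 10) - 3 / ((2 : ℝ) ^ 20 * (q : ℝ) ^ 10) := by
      field_simp; ring
    linarith

/-- **Uniform form**: `|T⋄ − p/q| ≥ 1/(2^50 · q^10)` for EVERY `q ≥ 1` (write `p/q = 8p/8q`). -/
theorem irrationality_measure_Tdia' (p : ℤ) {q : ℕ} (hq : 1 ≤ q) :
    1 / ((2 : ℝ) ^ 50 * (q : ℝ) ^ 10) ≤ |Tdia - (p : ℝ) / q| := by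
  have h := irrationality_measure_Tdia (8 * p) (q := 8 * q) (by omega)
  have hq0 : (q : ℝ) ≠ 0 := by exact_mod_cast (show q ≠ 0 by omega)
  have e : ((8 * p : ℤ) : ℝ) / ((8 * q : ℕ) : ℝ) = (p : ℝ) / q := by
    rw [div_eq_div_iff (by positivity) hq0]; push_cast; ring
  have e2 : (2 : ℝ) ^ 20 * (((8 * q : ℕ) : ℝ)) ^ 10 = (2 : ℝ) ^ 50 * (q : ℝ) ^ 10 := by
    rw [Nat.cast_mul, mul_pow]; norm_num; ring
  rw [e, e2] at h
  exact h

/-- For rationals: `|T⋄ − r| ≥ 1/(2^50 · den(r)^10)`. -/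
theorem Tdia_sub_rat_lower (r : ℚ) : 1 / ((2 : ℝ) ^ 50 * (r.den : ℝ) ^ 10) ≤ |Tdia - r| := by
  have h := irrationality_measure_Tdia' r.num (q := r.den) r.den_pos
  rwa [show ((r.num : ℤ) : ℝ) / (r.den : ℕ) = (r : ℝ) by exact_mod_cast Rat.num_div_den r] at h

/-- `exp(−x) ≤ 1/x` for `x > 0`. -/
private theorem exp_neg_le_one_div {x : ℝ} (hx : 0 < x) : Real.exp (-x) ≤ 1 / x := by
  rw [Real.exp_neg, ← one_div]
  exact one_div_le_one_div_of_le hx (by linarith [Real.add_one_le_exp x])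

/-- **`T⋄` is NOT hyper-Liouville** (hypothesis-free): the member's scale lies OUTSIDE lens 6's 1-fold class
`HyperLiouville` — and hence outside `ℚ·`(every decided point/scale class), while `T⋄/√2 = λ_H` is inside:
the twist relocates the hyper-approximability to `ℚ(√2)`. -/
theorem not_hyperLiouville_Tdia : ¬ HyperLiouville Tdia := by
  intro h
  obtain ⟨r, hden, -, hlt⟩ := h 60
  have hlow := Tdia_sub_rat_lower r
  have hd : (60 : ℝ) ≤ r.den := by exact_mod_cast hden
  have hd0 : (0 : ℝ) < r.den := by linarith
  have h1 : Real.exp (-((r.den : ℝ) ^ 60)) ≤ 1 / (r.den : ℝ) ^ 60 := exp_neg_le_one_div (by positivity)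
  have h2 : 1 / (r.den : ℝ) ^ 60 < 1 / ((2 : ℝ) ^ 50 * (r.den : ℝ) ^ 10) := by
    apply one_div_lt_one_div_of_lt (by positivity)
    have h50 : (2 : ℝ) ^ 50 < (r.den : ℝ) ^ 50 := pow_lt_pow_left₀ (by linarith) (by norm_num) (by norm_num)
    calc (2 : ℝ) ^ 50 * (r.den : ℝ) ^ 10 < (r.den : ℝ) ^ 50 * (r.den : ℝ) ^ 10 :=
          mul_lt_mul_of_pos_right h50 (pow_pos hd0 10)
      _ = (r.den : ℝ) ^ 60 := by ring
  have e : Real.exp (-(r.den : ℝ) ^ 60) = Real.exp (-((r.den : ℝ) ^ 60)) := rfl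
  linarith [hlt, hlow, h1, h2]

/-- **`T⋄` is NOT a Liouville number** (Mathlib's `Liouville`; hypothesis-free) — unlike EVERY scale of the four
decided 1E classes (hyper-Liouville, ultra, covered towers, dyadic 2-fold hyper: all Liouville). -/
theorem not_liouville_Tdia : ¬ Liouville Tdia := by
  intro h
  obtain ⟨a, b, hb, -, hlt⟩ := h 61
  obtain ⟨b', rfl⟩ : ∃ b' : ℕ, b = (b' : ℤ) := ⟨b.toNat, (Int.toNat_of_nonneg (by omega)).symm⟩
  have hb1 : 1 ≤ b' := by omega
  have hlow := irrationality_measure_Tdia' a hb1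
  have hbR : (2 : ℝ) ≤ b' := by exact_mod_cast (show (2 : ℕ) ≤ b' by omega)
  have hb0 : (0 : ℝ) < b' := by linarith
  have h2 : 1 / (b' : ℝ) ^ 61 ≤ 1 / ((2 : ℝ) ^ 50 * (b' : ℝ) ^ 10) := by
    apply one_div_le_one_div_of_le (by positivity)
    have h51 : (2 : ℝ) ^ 50 ≤ (b' : ℝ) ^ 51 :=
      calc (2 : ℝ) ^ 50 ≤ (2 : ℝ) ^ 51 := by norm_num
        _ ≤ (b' : ℝ) ^ 51 := pow_le_pow_left₀ (by norm_num) hbR 51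
    calc (2 : ℝ) ^ 50 * (b' : ℝ) ^ 10 ≤ (b' : ℝ) ^ 51 * (b' : ℝ) ^ 10 :=
          mul_le_mul_of_nonneg_right h51 (pow_pos hb0 10).le
      _ = (b' : ℝ) ^ 61 := by ring
  have e : ((b' : ℤ) : ℝ) = (b' : ℝ) := by norm_cast
  rw [e] at hlt
  linarith [hlt, hlow]

/-- **… yet `T⋄` IS hyper-approximable THROUGH `ℚ(√2)`** (the twist relocates the hyper-approximability to the
fixed quadratic field; with `irrationality_measure_Tdia` this places `T⋄` among Mahler's `U`-numbers of degree 2,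
LeVeque 1953): for every `m` there is a rational `r` with `den r ≥ m`, `T⋄ ≠ √2·r` and `|T⋄ − √2·r| < 2·exp(−den(r)^m)`. -/
theorem Tdia_hyper_through_sqrt_two (m : ℕ) :
    ∃ r : ℚ, m ≤ r.den ∧ Tdia ≠ Real.sqrt 2 * r ∧ |Tdia - Real.sqrt 2 * r| < 2 * Real.exp (-((r.den : ℝ) ^ m)) := by
  obtain ⟨r, hden, hne, hlt⟩ := hyperLiouville_lambdaH m
  have hs0 : 0 < Real.sqrt 2 := Real.sqrt_pos.mpr two_pos
  have hs2 : Real.sqrt 2 ^ 2 = 2 := Real.sq_sqrt (by norm_num)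
  have hs3 : Real.sqrt 2 < 2 := by nlinarith [hs2, hs0]
  refine ⟨r, hden, fun h => hne (mul_left_cancel₀ hs0.ne' (by rw [← h]; rfl)), ?_⟩
  have e : Tdia - Real.sqrt 2 * r = Real.sqrt 2 * (lambdaH - r) := by unfold Tdia; ring
  rw [e, abs_mul, abs_of_pos hs0]
  have h0 : 0 ≤ |lambdaH - r| := abs_nonneg _
  nlinarith [hlt, h0, Real.exp_pos (-((r.den : ℝ) ^ m))]

end Summit.Schanuel.Schanuel.Theorems.RootDecomp1EWallDichotomy

end
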